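/-
Copyright: statement-level skeleton of a published paper (lit-balaban cell, Phase-2 proof seat p20 gen 8). No proof claims
beyond what the kernel checks below.
-/
import Literature.MathematicalPhysics.QuantumFieldTheory.Balaban1983to89.B3GkTadpoleLimitZeroTorus
import Mathlib.Analysis.SpecialFunctions.Integrals.Basic

/-!
# B3 — T. Bałaban, *(Higgs)₂,₃ quantum fields in a finite volume. III. Renormalization*, CMP **88** (1983) 411–445
[Balaban1983Higgs3], p. 438 [PDF 28]: **"ηG_k(x,x) is convergent to some finite constant as η → 0"** — the RATE:
`0 ≤ K₃ − ξ·C^ξ(0) ≤ (3π/16)·ξ` for the free tadpole on `ξℤ³`, hence `|ηG_k(x,x) − K₃| ≤ C·η` for the zero-field torus propagator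
`G_k(T,0)` (`d = 3`), uniformly in the volume, `K₃ = (2π)^{−3}∫_{|q_μ|≤π} dq/Δ¹(q)`

statement-level skeleton of published theorems with citation tags; proofs where landed; nothing here is a claim about
the Yang–Mills mass gap

PDF held: `paper:balaban1983-higgs-2-3-quantum-fields-finite-volume` (journal page = PDF page + 410); p. 438 [PDF 28] read in the
OCR text `p0028.txt` and on the render
`run/shared/lean/pub/pub-balaban/b2b-balaban-ref1/pages/1983-cmp88-higgs23-III/1983-cmp88-higgs23-III-p028-x4.png`.

CITATION HEADER (lean-in-tree rule).  Part of the lit-balaban TYPED SKELETON (HOME `run/shared/lean/pub/lit-balaban/`), PHASE 2,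
seat p20 generation 8; rider to this seat's `B3GkTadpoleLimitZeroTorus` (p308686).  WHAT IS REPRODUCED: row **B3.Eq3.21-3.24** of
`HOME/lit-balaban-r15/ROWS-B3.md` (fold owner r15), the p. 438 sentence *"The expression corresponding to the first graph is in fact
convergent, because ηG_k(x,x) is convergent to some finite constant as η → 0"* — made QUANTITATIVE.

THE PROOF (ours; the paper gives none).  By p20 g4's `B3CxiTadpoleLimit.xi_mul_Cxi_zero_eq`,
`K₃ − ξC^ξ(0) = (2π)^{−3}∫_{|q_μ|≤π}[Δ¹(q)^{−1} − (Δ¹(q) + ξ²)^{−1}]dq`, with the integrand `ξ²/(Δ¹(Δ¹+ξ²)) ≥ 0` (off the origin)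
and, by Jordan's inequality `Δ¹(q) ≥ (4/π²)‖q‖²_∞` (r15's `B3CxiTadpole.norm_sq_le_lapSymbol`), at most the radial function
`ξ²/(cr²(cr² + ξ²))`, `c = 4/π²`, `r = ‖q‖_∞`.  Polar coordinates for the sup norm (Mathlib's `integral_fun_norm_addHaar`, the
unit sup-norm ball of `ℝ³` having volume `8`; the template of r15's `B3CxiTadpole.boxIntegral_le_radial`) turn the integral over the
ball of radius `π + 1 ⊇` the box into `24·∫₀^{π+1} ξ²dr/(c(cr² + ξ²)) = 24·(ξ²/c²)∫₀^{π+1}dr/(a² + r²)`, `a = πξ/2`, which Mathlib's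
`integral_inv_sq_add_sq` evaluates as `(ξ²/c²)·a^{−1}·arctan((π+1)/a) ≤ π⁴ξ/16`.  Hence **`tadpoleConst_sub_le`**:
`K₃ − ξC^ξ(0) ≤ (2π)^{−3}·24·(π⁴/16)·ξ = (3π/16)·ξ` and (**`xi_mul_Cxi_zero_le_tadpoleConst`**) `ξC^ξ(0) ≤ K₃`, i.e.
**`abs_xi_mul_Cxi_zero_sub_le`**: `|ξC^ξ(0) − K₃| ≤ (3π/16)·ξ` for every `ξ > 0`.  With `B3GkTadpoleLimitZeroTorus.abs_eta_mul_G0xi_diag_sub_le`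
(`|ηG_k(y,y) − ηC^η(0)| ≤ C·η`) this gives the quantitative form of the printed sentence at the zero-field torus instance, `d = 3`:
**`abs_eta_mul_G0xi_diag_sub_tadpoleConst_le`** — `|ξ·G^ξ_k(0;y,y) − K₃| ≤ C′·ξ`, `ξ = η = L^{−k}`, ONE `C′` for all volumes
`P = (3, L, m, K)`, all `1 ≤ k ≤ K`, all sites — and its tower / (3.21a)-vertex forms (`abs_eps_mul_Gk_diag_sub_tadpoleConst_le`,
**`abs_expr321a_sub_limit_le`**: the expression of the first graph of (3.21) equals the local vertex `Σ_μΣ_xη^dK₃g(x)φ(x)·q²(∂^η_μφ′)(x)`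
up to `C′η·Σ‖φ‖‖q²∂φ′‖`).

HONEST SCOPE: `d = 3`; the free-tadpole rate holds for every `ξ > 0`; the `G_k` statements at the model instance `A = B̃ = 0`,
`U ≡ 1`, `Ω` = the whole torus (as in every zero-torus file of rows B3.Eq2.10 / 3.11-3.17 / 3.21-3.24); constants of the `G_k`
statements existential (functions of `L, a, m²`).  Mathlib + the cited tree files only; theorems only — no `def`, no named fact,
no `sorry`; standard axioms.  Unit `lit-balaban-p20-g8` (Phase-2 proof seat p20, gen 8), HOME `run/shared/lean/pub/lit-balaban/`,
2026-08-21.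
-/

open scoped BigOperators RealInnerProductSpace Topology
open Filter

namespace Literature.MathematicalPhysics.QuantumFieldTheory.Balaban1983to89.B3CxiTadpoleRate

open Finset B1RG242Torus B3GkZeroTorusRescaled B3Sect3KernelsZeroTorus
open LatticeFieldCalculus B3Sect3ScalarSelfEnergy B3Sect3VectorSelfEnergy B3CxiPropagator B3CxiTadpole B3CxiTadpoleLimit
open B3Eq322OneLegDifferentiated B3Eq322PositiveDegree B3GkTadpoleLimitZeroTorus
open _root_.MeasureTheory _root_.Filter _root_.Set _root_.Metric

noncomputable section

universe u

/-! ## §1 The integrand of `K₃ − ξC^ξ(0)` and its radial majorant -/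

section Pointwise

/-- kernel: almost every point of the box (Lebesgue measure restricted to the box) lies in the box and is not the origin. [folklore] -/
private theorem ae_mem_bzBox_ne_zero :
    ∀ᵐ q ∂(volume.restrict (bzBox 3 1)), q ∈ bzBox 3 1 ∧ q ≠ (0 : Fin 3 → ℝ) := by
  have h1 : ∀ᵐ q ∂(volume.restrict (bzBox 3 1)), q ∈ bzBox 3 1 := ae_restrict_mem (measurableSet_bzBox 3 1)
  have h2 : ∀ᵐ q ∂(volume.restrict (bzBox 3 1)), q ≠ (0 : Fin 3 → ℝ) := by
    refine ae_restrict_of_ae ?_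
    have h0 : volume ({0} : Set (Fin 3 → ℝ)) = 0 := measure_singleton 0
    simpa only [mem_singleton_iff] using measure_eq_zero_iff_ae_notMem.1 h0
  filter_upwards [h1, h2] with q hq1 hq2 using ⟨hq1, hq2⟩

/-- kernel: `D⁻¹ − 1/(D + ξ²) = ξ²/(D(D + ξ²))` for `D > 0`. [folklore] -/
private theorem inv_sub_inv_add_eq {D ξ : ℝ} (hD : 0 < D) :
    D⁻¹ - 1 / (D + ξ ^ 2) = ξ ^ 2 / (D * (D + ξ ^ 2)) := by
  have h1 : D + ξ ^ 2 ≠ 0 := by positivity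
  field_simp
  ring

/-- The integrand of `K₃ − ξC^ξ(0)`, `Δ¹(q)^{−1} − (Δ¹(q) + ξ²)^{−1} = ξ²/(Δ¹(Δ¹ + ξ²))`, is nonnegative off the origin of the box.
[cite: Balaban1983Higgs3, (3.21) p.438] -/
theorem integrand_nonneg {ξ : ℝ} {q : Fin 3 → ℝ} (hq : q ∈ bzBox 3 1) (h0 : q ≠ 0) :
    0 ≤ (lapSymbol 3 1 q)⁻¹ - 1 / (lapSymbol 3 1 q + ξ ^ 2) := by
  have hL := lapSymbol_pos hq h0
  rw [inv_sub_inv_add_eq hL]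
  positivity

/-- **The radial majorant** (Jordan `Δ¹(q) ≥ (4/π²)‖q‖²_∞` on the box, and `t ↦ ξ²/(t(t+ξ²))` decreasing): for every `q` of the box,
`Δ¹(q)^{−1} − (Δ¹(q) + ξ²)^{−1} ≤ ξ²/(c‖q‖²(c‖q‖² + ξ²))`, `c = 4/π²` (at `q = 0` the left side is `−ξ^{−2} ≤ 0` in Mathlib's
conventions). [cite: Balaban1983Higgs3, (3.21) p.438] -/
theorem integrand_le_radial {ξ : ℝ} (hξ : 0 < ξ) {q : Fin 3 → ℝ} (hq : q ∈ bzBox 3 1) :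
    (lapSymbol 3 1 q)⁻¹ - 1 / (lapSymbol 3 1 q + ξ ^ 2) ≤
      ξ ^ 2 / (4 / Real.pi ^ 2 * ‖q‖ ^ 2 * (4 / Real.pi ^ 2 * ‖q‖ ^ 2 + ξ ^ 2)) := by
  by_cases h0 : q = 0
  · subst h0
    have hL : lapSymbol 3 1 (0 : Fin 3 → ℝ) = 0 := by simp [lapSymbol]
    have hle : (lapSymbol 3 1 (0 : Fin 3 → ℝ))⁻¹ - 1 / (lapSymbol 3 1 (0 : Fin 3 → ℝ) + ξ ^ 2) ≤ 0 := by
      rw [hL, inv_zero, zero_add, zero_sub, neg_nonpos]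
      positivity
    exact hle.trans (by positivity)
  · have hL := lapSymbol_pos hq h0
    have hJ := norm_sq_le_lapSymbol hq
    have hr : 0 < 4 / Real.pi ^ 2 * ‖q‖ ^ 2 := by
      have := norm_pos_iff.mpr h0
      positivity
    rw [inv_sub_inv_add_eq hL]
    refine div_le_div_of_nonneg_left (sq_nonneg ξ) (by positivity) ?_
    exact mul_le_mul hJ (by linarith) (by positivity) hL.le

end Pointwise

/-! ## §2 Polar coordinates for the sup norm of `ℝ³` and the one-dimensional integral -/

section Radial

/-- kernel (polar coordinates for the sup norm, the template of r15's `B3CxiTadpole.boxIntegral_le_radial`): for every `φ : ℝ → ℝ`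
and `R`, `∫_{‖q‖<R} φ(‖q‖) dq = 3·2³·∫₀^R y²φ(y) dy` on `ℝ³` — Mathlib's `integral_fun_norm_addHaar`, the sup-norm unit ball
having Lebesgue volume `2³`. [folklore] -/
private theorem integral_ball_norm (φ : ℝ → ℝ) (R : ℝ) :
    ∫ q in ball (0 : Fin 3 → ℝ) R, φ ‖q‖ = 3 * 2 ^ 3 * ∫ y in Ioo 0 R, y ^ 2 * φ y := by
  set g : ℝ → ℝ := fun y => if y < R then φ y else 0 with hg
  have h1 : (fun q : Fin 3 → ℝ => g ‖q‖) = (ball (0 : Fin 3 → ℝ) R).indicator fun q => φ ‖q‖ := by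
    funext q
    by_cases hq : ‖q‖ < R
    · rw [indicator_of_mem (mem_ball_zero_iff.2 hq)]
      simp [hg, hq]
    · rw [indicator_of_notMem (fun h => hq (mem_ball_zero_iff.1 h))]
      simp [hg, hq]
  have h2 := MeasureTheory.integral_fun_norm_addHaar (volume : Measure (Fin 3 → ℝ)) g
  rw [h1, integral_indicator measurableSet_ball] at h2
  refine h2.trans ?_
  have hdim : Module.finrank ℝ (Fin 3 → ℝ) = 3 := by simp
  have hvol : (volume : Measure (Fin 3 → ℝ)).real (ball 0 1) = 2 ^ 3 := by
    rw [measureReal_def, Real.volume_pi_ball 0 one_pos, ENNReal.toReal_ofReal (by positivity)]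
    simp
  have h3 : (fun y : ℝ => y ^ (Module.finrank ℝ (Fin 3 → ℝ) - 1) • g y) =
      (Iio R).indicator fun y => y ^ 2 * φ y := by
    funext y
    rw [hdim, smul_eq_mul]
    by_cases hy : y < R
    · rw [indicator_of_mem (Set.mem_Iio.2 hy)]
      simp [hg, hy]
    · rw [indicator_of_notMem (fun h => hy (Set.mem_Iio.1 h))]
      simp [hg, hy]
  rw [h3, setIntegral_indicator measurableSet_Iio, Ioi_inter_Iio, hdim, hvol]
  simp only [nsmul_eq_mul, smul_eq_mul]
  ring

/-- kernel (the integrability half of the polar-coordinates template): if `y ↦ y²φ(y)` is integrable on `(0, R)` then `q ↦ φ(‖q‖)` is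
integrable on the sup-norm ball of radius `R` of `ℝ³`. [folklore] -/
private theorem integrableOn_ball_norm {φ : ℝ → ℝ} {R : ℝ}
    (hφ : IntegrableOn (fun y => y ^ 2 * φ y) (Ioo 0 R)) :
    IntegrableOn (fun q : Fin 3 → ℝ => φ ‖q‖) (ball 0 R) := by
  set g : ℝ → ℝ := fun y => if y < R then φ y else 0 with hg
  have h1 : (fun q : Fin 3 → ℝ => g ‖q‖) = (ball (0 : Fin 3 → ℝ) R).indicator fun q => φ ‖q‖ := by
    funext q
    by_cases hq : ‖q‖ < R
    · rw [indicator_of_mem (mem_ball_zero_iff.2 hq)]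
      simp [hg, hq]
    · rw [indicator_of_notMem (fun h => hq (mem_ball_zero_iff.1 h))]
      simp [hg, hq]
  have hdim : Module.finrank ℝ (Fin 3 → ℝ) = 3 := by simp
  have h3 : (fun y : ℝ => y ^ (Module.finrank ℝ (Fin 3 → ℝ) - 1) • g y) =
      (Iio R).indicator fun y => y ^ 2 * φ y := by
    funext y
    rw [hdim, smul_eq_mul]
    by_cases hy : y < R
    · rw [indicator_of_mem (Set.mem_Iio.2 hy)]
      simp [hg, hy]
    · rw [indicator_of_notMem (fun h => hy (Set.mem_Iio.1 h))]
      simp [hg, hy]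
  rw [← integrable_indicator_iff measurableSet_ball, ← h1,
    MeasureTheory.integrable_fun_norm_addHaar (volume : Measure (Fin 3 → ℝ)), h3,
    integrableOn_indicator_iff measurableSet_Iio, Set.inter_comm, Ioi_inter_Iio]
  exact hφ

/-- kernel: the substitution behind the one-dimensional integral — for `y ≠ 0`,
`y²·ξ²/(cy²(cy² + ξ²)) = (ξ²/c²)·(a² + y²)^{−1}`, `c = 4/π²`, `a = πξ/2` (`c·a² = ξ²`). [folklore] -/
private theorem sq_mul_radial_eq (ξ : ℝ) {y : ℝ} (hy : y ≠ 0) :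
    y ^ 2 * (ξ ^ 2 / (4 / Real.pi ^ 2 * y ^ 2 * (4 / Real.pi ^ 2 * y ^ 2 + ξ ^ 2))) =
      ξ ^ 2 / (4 / Real.pi ^ 2) ^ 2 * ((Real.pi * ξ / 2) ^ 2 + y ^ 2)⁻¹ := by
  have hπ : Real.pi ≠ 0 := Real.pi_pos.ne'
  have h1 : 4 / Real.pi ^ 2 * y ^ 2 + ξ ^ 2 ≠ 0 := by positivity
  have h2 : (Real.pi * ξ / 2) ^ 2 + y ^ 2 ≠ 0 := by positivity
  field_simp
  ring

/-- kernel: the one-dimensional radial integrand `y²·ξ²/(cy²(cy² + ξ²))` is integrable on `(0, π+1)` (it agrees there with the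
continuous `(ξ²/c²)(a² + y²)^{−1}`, `a = πξ/2 > 0`). [folklore] -/
private theorem integrableOn_radial_oneDim {ξ : ℝ} (hξ : 0 < ξ) :
    IntegrableOn (fun y : ℝ => y ^ 2 * (ξ ^ 2 / (4 / Real.pi ^ 2 * y ^ 2 * (4 / Real.pi ^ 2 * y ^ 2 + ξ ^ 2))))
      (Ioo 0 (Real.pi + 1)) := by
  have ha : 0 < Real.pi * ξ / 2 := by positivity
  have h0 : ∀ y : ℝ, (Real.pi * ξ / 2) ^ 2 + y ^ 2 ≠ 0 := fun y => by positivity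
  have hcont : Continuous fun y : ℝ => ξ ^ 2 / (4 / Real.pi ^ 2) ^ 2 * ((Real.pi * ξ / 2) ^ 2 + y ^ 2)⁻¹ :=
    continuous_const.mul ((continuous_const.add (continuous_pow 2)).inv₀ h0)
  refine (hcont.continuousOn.integrableOn_Icc.mono_set Ioo_subset_Icc_self).congr_fun ?_ measurableSet_Ioo
  exact fun y hy => (sq_mul_radial_eq ξ hy.1.ne').symm

/-- kernel: **the one-dimensional integral**, `∫₀^{π+1} y²·ξ²dy/(cy²(cy² + ξ²)) = (ξ²/c²)·a^{−1}·arctan((π+1)/a) ≤ π⁴ξ/16`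
(`c = 4/π²`, `a = πξ/2`; Mathlib's `integral_inv_sq_add_sq` and `arctan < π/2`). [folklore] -/
private theorem integral_radial_oneDim_le {ξ : ℝ} (hξ : 0 < ξ) :
    ∫ y in Ioo 0 (Real.pi + 1), y ^ 2 * (ξ ^ 2 / (4 / Real.pi ^ 2 * y ^ 2 * (4 / Real.pi ^ 2 * y ^ 2 + ξ ^ 2))) ≤
      Real.pi ^ 4 / 16 * ξ := by
  set a : ℝ := Real.pi * ξ / 2 with ha
  have ha0 : 0 < a := by positivity
  have hR : (0 : ℝ) ≤ Real.pi + 1 := by positivity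
  have heq : EqOn (fun y : ℝ => y ^ 2 * (ξ ^ 2 / (4 / Real.pi ^ 2 * y ^ 2 * (4 / Real.pi ^ 2 * y ^ 2 + ξ ^ 2))))
      (fun y => ξ ^ 2 / (4 / Real.pi ^ 2) ^ 2 * (a ^ 2 + y ^ 2)⁻¹) (Ioo 0 (Real.pi + 1)) :=
    fun y hy => sq_mul_radial_eq ξ hy.1.ne'
  rw [setIntegral_congr_fun measurableSet_Ioo heq, ← integral_Ioc_eq_integral_Ioo,
    ← intervalIntegral.integral_of_le hR, intervalIntegral.integral_const_mul, integral_inv_sq_add_sq ha0.ne',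
    zero_div, Real.arctan_zero, sub_zero]
  have hat : Real.arctan ((Real.pi + 1) / a) ≤ Real.pi / 2 := (Real.arctan_lt_pi_div_two _).le
  have hc : 0 ≤ ξ ^ 2 / (4 / Real.pi ^ 2) ^ 2 := by positivity
  have hai : 0 ≤ a⁻¹ := inv_nonneg.mpr ha0.le
  calc ξ ^ 2 / (4 / Real.pi ^ 2) ^ 2 * (a⁻¹ * Real.arctan ((Real.pi + 1) / a))
      ≤ ξ ^ 2 / (4 / Real.pi ^ 2) ^ 2 * (a⁻¹ * (Real.pi / 2)) :=
        mul_le_mul_of_nonneg_left (mul_le_mul_of_nonneg_left hat hai) hc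
    _ = Real.pi ^ 4 / 16 * ξ := by
        rw [ha]
        have hπ : Real.pi ≠ 0 := Real.pi_pos.ne'
        have hξ0 : ξ ≠ 0 := hξ.ne'
        field_simp
        ring

end Radial

/-! ## §3 The rate for the free tadpole: `0 ≤ K₃ − ξC^ξ(0) ≤ (3π/16)·ξ` -/

section Rate

/-- kernel: the Brillouin box is compact. [folklore] -/
private theorem isCompact_bzBox_one : IsCompact (bzBox 3 1) := by
  rw [bzBox_one_eq_Icc]
  exact isCompact_Icc

/-- kernel: the massive integrand `1/(Δ¹ + ξ²)` is integrable on the box (`ξ > 0`: continuous on a compact set). [folklore] -/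
private theorem integrableOn_inv_lapSymbol_add {ξ : ℝ} (hξ : 0 < ξ) :
    IntegrableOn (fun q : Fin 3 → ℝ => 1 / (lapSymbol 3 1 q + ξ ^ 2)) (bzBox 3 1) volume := by
  have hcont : Continuous fun q : Fin 3 → ℝ => 1 / (lapSymbol 3 1 q + ξ ^ 2) :=
    continuous_const.div ((continuous_lapSymbol 3 1).add continuous_const) fun q => by
      have := lapSymbol_nonneg 3 1 q
      positivity
  exact hcont.continuousOn.integrableOn_compact isCompact_bzBox_one

/-- kernel: the box lies in the open sup-norm ball of radius `π + 1`. [folklore] -/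
private theorem bzBox_subset_ball : bzBox 3 1 ⊆ ball (0 : Fin 3 → ℝ) (Real.pi + 1) :=
  bzBox_subset_closedBall.trans (closedBall_subset_ball (by linarith))

/-- **`K₃ − ξC^ξ(0)` as one box integral**: `K₃ − ξ·C^ξ(0) = (2π)^{−3}∫_{|q_μ|≤π}[Δ¹(q)^{−1} − (Δ¹(q) + ξ²)^{−1}]dq` (`ξ > 0`; p20 g4's
`xi_mul_Cxi_zero_eq` and the integrability of both terms). [cite: Balaban1983Higgs3, (3.21) p.438] -/
theorem tadpoleConst_sub_eq {ξ : ℝ} (hξ : 0 < ξ) :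
    (2 * Real.pi)⁻¹ ^ 3 * (∫ q in bzBox 3 1, (lapSymbol 3 1 q)⁻¹) - ξ * Cxi 3 ξ 0 =
      (2 * Real.pi)⁻¹ ^ 3 * ∫ q in bzBox 3 1, ((lapSymbol 3 1 q)⁻¹ - 1 / (lapSymbol 3 1 q + ξ ^ 2)) := by
  rw [xi_mul_Cxi_zero_eq hξ, ← mul_sub, integral_sub integrableOn_inv_lapSymbol (integrableOn_inv_lapSymbol_add hξ)]

/-- **`ξ·C^ξ(0) ≤ K₃`** (`ξ > 0`): the rescaled free tadpole lies below its limit (the integrand of `K₃ − ξC^ξ(0)` is nonnegative off the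
Lebesgue-null origin). [cite: Balaban1983Higgs3, (3.21) p.438] -/
theorem xi_mul_Cxi_zero_le_tadpoleConst {ξ : ℝ} (hξ : 0 < ξ) :
    ξ * Cxi 3 ξ 0 ≤ (2 * Real.pi)⁻¹ ^ 3 * ∫ q in bzBox 3 1, (lapSymbol 3 1 q)⁻¹ := by
  have h := tadpoleConst_sub_eq hξ
  have hI : 0 ≤ ∫ q in bzBox 3 1, ((lapSymbol 3 1 q)⁻¹ - 1 / (lapSymbol 3 1 q + ξ ^ 2)) := by
    refine setIntegral_nonneg_of_ae_restrict ?_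
    filter_upwards [ae_mem_bzBox_ne_zero] with q hq
    exact integrand_nonneg hq.1 hq.2
  have h2 : 0 ≤ (2 * Real.pi)⁻¹ ^ 3 * ∫ q in bzBox 3 1, ((lapSymbol 3 1 q)⁻¹ - 1 / (lapSymbol 3 1 q + ξ ^ 2)) := by
    positivity
  linarith

/-- **THE RATE for the free tadpole**: `K₃ − ξ·C^ξ(0) ≤ (3π/16)·ξ` for every `ξ > 0` — the box integral of the radial majorant is
at most its integral over the sup-norm ball of radius `π + 1`, `= 24·∫₀^{π+1}y²·ξ²dy/(cy²(cy²+ξ²)) ≤ 24·π⁴ξ/16`, and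
`(2π)^{−3}·24·π⁴/16 = 3π/16`. [cite: Balaban1983Higgs3, (3.21) p.438] -/
theorem tadpoleConst_sub_le {ξ : ℝ} (hξ : 0 < ξ) :
    (2 * Real.pi)⁻¹ ^ 3 * (∫ q in bzBox 3 1, (lapSymbol 3 1 q)⁻¹) - ξ * Cxi 3 ξ 0 ≤ 3 * Real.pi / 16 * ξ := by
  rw [tadpoleConst_sub_eq hξ]
  have hNint : IntegrableOn
      (fun q : Fin 3 → ℝ => ξ ^ 2 / (4 / Real.pi ^ 2 * ‖q‖ ^ 2 * (4 / Real.pi ^ 2 * ‖q‖ ^ 2 + ξ ^ 2)))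
      (ball 0 (Real.pi + 1)) :=
    integrableOn_ball_norm (φ := fun y => ξ ^ 2 / (4 / Real.pi ^ 2 * y ^ 2 * (4 / Real.pi ^ 2 * y ^ 2 + ξ ^ 2)))
      (integrableOn_radial_oneDim hξ)
  have hfint : IntegrableOn (fun q : Fin 3 → ℝ => (lapSymbol 3 1 q)⁻¹ - 1 / (lapSymbol 3 1 q + ξ ^ 2)) (bzBox 3 1) :=
    integrableOn_inv_lapSymbol.sub (integrableOn_inv_lapSymbol_add hξ)
  have h1 : ∫ q in bzBox 3 1, ((lapSymbol 3 1 q)⁻¹ - 1 / (lapSymbol 3 1 q + ξ ^ 2)) ≤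
      ∫ q in bzBox 3 1, ξ ^ 2 / (4 / Real.pi ^ 2 * ‖q‖ ^ 2 * (4 / Real.pi ^ 2 * ‖q‖ ^ 2 + ξ ^ 2)) :=
    setIntegral_mono_on hfint (hNint.mono_set bzBox_subset_ball) (measurableSet_bzBox 3 1)
      fun q hq => integrand_le_radial hξ hq
  have h2 : ∫ q in bzBox 3 1, ξ ^ 2 / (4 / Real.pi ^ 2 * ‖q‖ ^ 2 * (4 / Real.pi ^ 2 * ‖q‖ ^ 2 + ξ ^ 2)) ≤
      ∫ q in ball (0 : Fin 3 → ℝ) (Real.pi + 1),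
        ξ ^ 2 / (4 / Real.pi ^ 2 * ‖q‖ ^ 2 * (4 / Real.pi ^ 2 * ‖q‖ ^ 2 + ξ ^ 2)) :=
    setIntegral_mono_set hNint (ae_of_all _ fun q => by positivity) bzBox_subset_ball.eventuallyLE
  have h3 := integral_ball_norm (fun y => ξ ^ 2 / (4 / Real.pi ^ 2 * y ^ 2 * (4 / Real.pi ^ 2 * y ^ 2 + ξ ^ 2))) (Real.pi + 1)
  have h4 := integral_radial_oneDim_le hξ
  have hpos : 0 ≤ (2 * Real.pi)⁻¹ ^ 3 := by positivity
  calc (2 * Real.pi)⁻¹ ^ 3 * ∫ q in bzBox 3 1, ((lapSymbol 3 1 q)⁻¹ - 1 / (lapSymbol 3 1 q + ξ ^ 2))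
      ≤ (2 * Real.pi)⁻¹ ^ 3 * (3 * 2 ^ 3 * (Real.pi ^ 4 / 16 * ξ)) := by
        refine mul_le_mul_of_nonneg_left ?_ hpos
        refine (h1.trans h2).trans ?_
        rw [h3]
        exact mul_le_mul_of_nonneg_left h4 (by norm_num)
    _ = 3 * Real.pi / 16 * ξ := by
        have hπ : Real.pi ≠ 0 := Real.pi_pos.ne'
        field_simp

/-- **`|ξ·C^ξ(0) − K₃| ≤ (3π/16)·ξ` for every `ξ > 0`** — the quantitative form of p20 g4's `tendsto_xi_mul_Cxi_zero_three`
(*"ηG_k(x,x) is convergent to some finite constant as η → 0"* for the free propagator, with the RATE `O(η)`).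
[cite: Balaban1983Higgs3, (3.21) p.438] -/
theorem abs_xi_mul_Cxi_zero_sub_le {ξ : ℝ} (hξ : 0 < ξ) :
    |ξ * Cxi 3 ξ 0 - (2 * Real.pi)⁻¹ ^ 3 * ∫ q in bzBox 3 1, (lapSymbol 3 1 q)⁻¹| ≤ 3 * Real.pi / 16 * ξ := by
  have h1 := xi_mul_Cxi_zero_le_tadpoleConst hξ
  have h2 := tadpoleConst_sub_le hξ
  rw [abs_sub_comm, abs_of_nonneg (by linarith)]
  exact h2

/-- Numeral form: `|ξ·C^ξ(0) − K₃| ≤ ξ` (`3π/16 < 1`). [cite: Balaban1983Higgs3, (3.21) p.438] -/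
theorem abs_xi_mul_Cxi_zero_sub_le' {ξ : ℝ} (hξ : 0 < ξ) :
    |ξ * Cxi 3 ξ 0 - (2 * Real.pi)⁻¹ ^ 3 * ∫ q in bzBox 3 1, (lapSymbol 3 1 q)⁻¹| ≤ ξ := by
  refine (abs_xi_mul_Cxi_zero_sub_le hξ).trans ?_
  have hπ := Real.pi_lt_four
  nlinarith

end Rate

/-! ## §4 The rate for `ηG_k(x,x)` at the zero-field torus instance (`d = 3`), uniformly in the volume -/

section Torus

/-- **p. 438, "ηG_k(x,x) is convergent to some finite constant as η → 0" — WITH THE RATE `O(η)`, zero-field torus instance,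
`d = 3`**: for odd `L > 1`, `a > 0`, `m² ≥ 0` there is `C > 0` (a function of `L, a, m²`) such that for EVERY volume `P = (3, L, m, K)`,
every `1 ≤ k ≤ K` and every site `y`: `|ξ·G^ξ_k(0;y,y) − K₃| ≤ C·ξ`, `ξ = η = L^{−k}`, `K₃ = (2π)^{−3}∫_{|q_μ|≤π}dq/Δ¹(q)` (this seat's
`abs_eta_mul_G0xi_diag_sub_le` + `abs_xi_mul_Cxi_zero_sub_le`). [cite: Balaban1983Higgs3, (3.21) p.438] -/
theorem abs_eta_mul_G0xi_diag_sub_tadpoleConst_le (L : ℕ) (hL : Odd L ∧ 1 < L) {a : ℝ} (ha : 0 < a) {msq : ℝ}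
    (hmsq : 0 ≤ msq) :
    ∃ C : ℝ, 0 < C ∧ ∀ (P : Params), P.d = 3 → P.L = L → ∀ k : ℕ, 1 ≤ k → k ≤ P.K → ∀ y : Site P 0,
      |P.eta k * G0xi P a msq k y y - (2 * Real.pi)⁻¹ ^ 3 * ∫ q in bzBox 3 1, (lapSymbol 3 1 q)⁻¹| ≤ C * P.eta k := by
  obtain ⟨C, hC, H⟩ := abs_eta_mul_G0xi_diag_sub_le L hL ha hmsq
  refine ⟨C + 3 * Real.pi / 16, by positivity, fun P hPd hPL k hk1 hkK y => ?_⟩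
  have h1 := H P hPd hPL k hk1 hkK y
  have h2 := abs_xi_mul_Cxi_zero_sub_le (eta_pos P k)
  calc |P.eta k * G0xi P a msq k y y - (2 * Real.pi)⁻¹ ^ 3 * ∫ q in bzBox 3 1, (lapSymbol 3 1 q)⁻¹|
      ≤ |P.eta k * G0xi P a msq k y y - P.eta k * Cxi 3 (P.eta k) 0| +
          |P.eta k * Cxi 3 (P.eta k) 0 - (2 * Real.pi)⁻¹ ^ 3 * ∫ q in bzBox 3 1, (lapSymbol 3 1 q)⁻¹| :=
        abs_sub_le _ _ _
    _ ≤ C * P.eta k + 3 * Real.pi / 16 * P.eta k := add_le_add h1 h2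
    _ = (C + 3 * Real.pi / 16) * P.eta k := by ring

/-- The same on the finest torus for the resummed tower `G^η_k = Σ_{i<k}G^η_{(i)}` (p18 g8's dictionary
`ε·G^η_k(x,x) = ξ·G^ξ_k(0;x,x)`): `|ε·G^η_k(x,x) − K₃| ≤ C·ξ`, uniformly in the volume and `1 ≤ k ≤ K`.
[cite: Balaban1983Higgs3, (3.21) p.438] -/
theorem abs_eps_mul_Gk_diag_sub_tadpoleConst_le (L : ℕ) (hL : Odd L ∧ 1 < L) {a : ℝ} (ha : 0 < a) {msq : ℝ}
    (hmsq : 0 ≤ msq) :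
    ∃ C : ℝ, 0 < C ∧ ∀ (P : Params), P.d = 3 → P.L = L → ∀ k : ℕ, 1 ≤ k → k ≤ P.K → ∀ x : Site P 0,
      |P.eps * (∑ i ∈ range k, gpiece P a msq k i) x x - (2 * Real.pi)⁻¹ ^ 3 * ∫ q in bzBox 3 1, (lapSymbol 3 1 q)⁻¹| ≤
        C * P.eta k := by
  obtain ⟨C, hC, H⟩ := abs_eta_mul_G0xi_diag_sub_tadpoleConst_le L hL ha hmsq
  refine ⟨C, hC, fun P hPd hPL k hk1 hkK x => ?_⟩
  rw [eps_mul_sum_gpiece_diag ha hmsq hPd hk1 x]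
  exact H P hPd hPL k hk1 hkK x

variable {W : Type u} [NormedAddCommGroup W] [InnerProductSpace ℝ W]

/-- **(3.21), first graph, "in fact convergent" — WITH THE RATE `O(η)`** (zero-field torus instance, `d = 3`): for odd `L > 1`,
`a > 0`, `m² ≥ 0` there is `C > 0` such that for every volume, every `1 ≤ k ≤ K`, every charge matrix `q`, every localization
`|g| ≤ 1` and all fields `φ, φ′`, the expression of graph (a) of (3.21) on `G^η_k` (p18 g8's `expr321a`) differs from the LOCAL
vertex `Σ_μΣ_xη^d·K₃·g(x)·φ(x)·q²(∂^η_μφ′)(x)` by at most `C·ξ·Σ_μΣ_xη^d‖φ(x)‖‖q²(∂^η_μφ′)(x)‖`, `ξ = L^{−k}`.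
[cite: Balaban1983Higgs3, (3.21) p.438] -/
theorem abs_expr321a_sub_limit_le (L : ℕ) (hL : Odd L ∧ 1 < L) {a : ℝ} (ha : 0 < a) {msq : ℝ} (hmsq : 0 ≤ msq) :
    ∃ C : ℝ, 0 < C ∧ ∀ (P : Params), P.d = 3 → P.L = L → ∀ k : ℕ, 1 ≤ k → k ≤ P.K →
      ∀ {W : Type u} [NormedAddCommGroup W] [InnerProductSpace ℝ W] (q : W →ₗ[ℝ] W) (g : SiteField P 0 ℝ)
        (φ φ' : SiteField P 0 W), (∀ x, |g x| ≤ 1) →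
        |expr321a P.eps q (∑ i ∈ range k, gpiece P a msq k i) g φ φ' -
            ∑ μ : Fin P.d, ∑ x : Site P 0, P.eps ^ P.d *
              (((2 * Real.pi)⁻¹ ^ 3 * ∫ p in bzBox 3 1, (lapSymbol 3 1 p)⁻¹) * g x *
                ⟪φ x, q (q (pdiff P.eps⁻¹ μ φ' x))⟫)| ≤
          C * P.eta k * ∑ μ : Fin P.d, ∑ x : Site P 0, P.eps ^ P.d * (‖φ x‖ * ‖q (q (pdiff P.eps⁻¹ μ φ' x))‖) := by
  obtain ⟨C, hC, H⟩ := abs_eps_mul_Gk_diag_sub_tadpoleConst_le L hL ha hmsq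
  refine ⟨C, hC, fun P hPd hPL k hk1 hkK W _ _ q g φ φ' hg => ?_⟩
  exact abs_expr321a_sub_const_le P.eps_pos.le q _ g hg (fun x => H P hPd hPL k hk1 hkK x) φ φ'

end Torus

end

end Literature.MathematicalPhysics.QuantumFieldTheory.Balaban1983to89.B3CxiTadpoleRate
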